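import Literature.NumberTheory.Sieve.RoughOmegaCells
import HarnessLib

/-!
# Bombieri–Vinogradov for the `Ω`-cells of the rough integers, I: the cell as a bilinear form

Topic `Literature/NumberTheory/Sieve`, sub-namespace `RoughCellsAP` (companion of
`RoughOmegaCellsClassesEquidistribution.lean`, which treats a FIXED modulus).  Everything here is
PROVED and purely combinatorial.  Write `Φ_{j+1}(X, Y) = {b ∈ roughIcc N₀ T : Ω b = j + 1}`
(`N₀ = ⌈Y⌉`, `T = ⌊X⌋`) for an `Ω`-cell of the `N₀`-rough integers.  The averaged (Bombieri–Vinogradov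
type) equidistribution of the cells in progressions (Motohashi 1976; Bombieri–Friedlander–Iwaniec
1986, Theorem 0) rests on writing the cell as a bilinear form: the set of pairs
`pairs N₀ T j = {(m, p) : m ∈ Φ_j, p prime ≥ N₀, m p ≤ T}` maps onto `Φ_{j+1}` by `(m, p) ↦ m p`,
the fibre of `b` being its set of prime factors, so that

* `sum_pairs_eq_sum_cell` — `Σ_{(m,p)} g(mp) = Σ_{b ∈ Φ_{j+1}} ω(b) g(b)` for every `g`;
* `omega_le_of_mem_cell`, `omega_eq_iff_squarefree_of_mem_cell` — on the cell `ω ≤ j + 1` with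
  equality exactly on the squarefree members;
* `sub_card_pairs_filter_nonneg`, `sub_card_pairs_filter_le` — hence `(j+1) #{b ∈ Φ_{j+1} : P b}`
  exceeds `#{(m,p) : P(mp)}` by at most `(j+1) · #{b ≤ T non-squarefree, rough, P b}`;
* `abs_cellClassDisc_le_abs_pairDisc_add` — the discrepancy of the cell in a reduced class is at most
  the discrepancy of the pairs plus the non-squarefree counts.

## References

* Y. Motohashi, *An induction principle for the generalization of Bombieri's prime number theorem*,
  Proc. Japan Acad. 52 (1976), 273–275.
* E. Bombieri, J. B. Friedlander, H. Iwaniec, *Primes in arithmetic progressions to large moduli*,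
  Acta Math. 156 (1986), 203–251, Theorem 0. [BombieriFriedlanderIwaniecActa1986]
-/

open Finset
open scoped ArithmeticFunction.Omega ArithmeticFunction.omega

namespace Literature.NumberTheory.Sieve

namespace RoughCellsAP

/-! Local notation (repeated verbatim in the companion files): the `Ω = i` cell of the `N₀`-rough
integers up to `T`, the primes `p ≥ N₀` up to `T`, and the pairs `(m, p)` with `m p ≤ T`. -/
local notation3 (prettyPrint := false) "cellΩ" N₀:max T:max i:max =>
  Finset.filter (fun b : ℕ => ArithmeticFunction.cardFactors b = i) (roughIcc N₀ T)
local notation3 (prettyPrint := false) "primesIn" N₀:max T:max =>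
  Finset.filter (fun p : ℕ => Nat.Prime p ∧ N₀ ≤ p) (Finset.Icc 1 T)
local notation3 (prettyPrint := false) "pairs" N₀:max T:max j:max =>
  Finset.filter (fun x : ℕ × ℕ => x.1 * x.2 ≤ T) ((cellΩ N₀ T j) ×ˢ (primesIn N₀ T))

/-! ### The product map -/

/-- Unpacking membership in the pair set. [folklore] -/
theorem mem_pairs_iff {N₀ T j : ℕ} {x : ℕ × ℕ} :
    x ∈ pairs N₀ T j ↔ (x.1 ∈ roughIcc N₀ T ∧ Ω x.1 = j) ∧ ((1 ≤ x.2 ∧ x.2 ≤ T) ∧ x.2.Prime ∧ N₀ ≤ x.2) ∧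
      x.1 * x.2 ≤ T := by
  simp only [Finset.mem_filter, Finset.mem_product, Finset.mem_Icc]
  tauto

/-- The product of a pair lies in the cell `Ω = j + 1`. [folklore] -/
theorem mul_mem_cell {N₀ T j : ℕ} {x : ℕ × ℕ} (hx : x ∈ pairs N₀ T j) : x.1 * x.2 ∈ cellΩ N₀ T (j + 1) := by
  obtain ⟨⟨hm, hmj⟩, ⟨-, hp, hNp⟩, hle⟩ := mem_pairs_iff.1 hx
  rw [mem_roughIcc] at hm
  obtain ⟨⟨hm1, -⟩, hmr⟩ := hm
  have hm0 : x.1 ≠ 0 := by omega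
  rw [Finset.mem_filter, mem_roughIcc]
  refine ⟨⟨⟨Nat.mul_pos (by omega) hp.pos, hle⟩, fun r hr hrd => ?_⟩, ?_⟩
  · rcases (Nat.Prime.dvd_mul hr).1 hrd with h | h
    · exact hmr r hr h
    · rw [(Nat.prime_dvd_prime_iff_eq hr hp).1 h]; exact hNp
  · rw [ArithmeticFunction.cardFactors_mul hm0 hp.ne_zero, hmj,
      ArithmeticFunction.cardFactors_apply_prime hp]

/-- Unpacking membership in the cell. [folklore] -/
theorem mem_cell_iff {N₀ T i b : ℕ} :
    b ∈ cellΩ N₀ T i ↔ ((1 ≤ b ∧ b ≤ T) ∧ ∀ p : ℕ, p.Prime → p ∣ b → N₀ ≤ p) ∧ Ω b = i := by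
  rw [Finset.mem_filter, mem_roughIcc]

/-- **The fibre of `b` is its set of prime factors**: for `b` in the cell `Ω = j + 1`, the pairs
`(m, p)` with `m p = b` are exactly the `(b/p, p)`, `p ∣ b` prime, so there are `ω(b)` of them.
[folklore] -/
theorem card_pairs_filter_mul_eq {N₀ T j b : ℕ} (hb : b ∈ cellΩ N₀ T (j + 1)) :
    #((pairs N₀ T j).filter (fun x : ℕ × ℕ => x.1 * x.2 = b)) = ω b := by
  obtain ⟨⟨⟨hb1, hbT⟩, hbr⟩, hbΩ⟩ := mem_cell_iff.1 hb
  have hb0 : b ≠ 0 := by omega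
  rw [ArithmeticFunction.cardDistinctFactors_apply, ← List.card_toFinset, Nat.toFinset_factors]
  symm
  refine Finset.card_nbij' (fun p => (b / p, p)) (fun x => x.2) ?_ ?_ ?_ ?_
  · intro p hp
    rw [Finset.mem_coe, Nat.mem_primeFactors] at hp
    obtain ⟨hp, hpb, -⟩ := hp
    have hdiv : b / p * p = b := Nat.div_mul_cancel hpb
    have hq0 : b / p ≠ 0 := by
      intro h; rw [h, zero_mul] at hdiv; exact hb0 hdiv.symm
    rw [Finset.mem_coe, Finset.mem_filter, mem_pairs_iff]
    refine ⟨⟨⟨?_, ?_⟩, ⟨⟨hp.one_lt.le, (Nat.le_of_dvd (by omega) hpb).trans hbT⟩, hp, hbr p hp hpb⟩,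
      hdiv.le.trans hbT⟩, hdiv⟩
    · rw [mem_roughIcc]
      refine ⟨⟨Nat.pos_of_ne_zero hq0, (Nat.div_le_self b p).trans hbT⟩, fun r hr hrd => ?_⟩
      exact hbr r hr (hrd.trans (Nat.div_dvd_of_dvd hpb))
    · have h := ArithmeticFunction.cardFactors_mul hq0 hp.ne_zero
      rw [hdiv, hbΩ, ArithmeticFunction.cardFactors_apply_prime hp] at h
      show Ω (b / p) = j
      omega
  · intro x hx
    rw [Finset.mem_coe, Finset.mem_filter, mem_pairs_iff] at hx
    obtain ⟨⟨-, ⟨-, hp, -⟩, -⟩, hxb⟩ := hx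
    rw [Finset.mem_coe, Nat.mem_primeFactors]
    exact ⟨hp, ⟨x.1, by rw [← hxb, mul_comm]⟩, hb0⟩
  · intro p _; rfl
  · intro x hx
    rw [Finset.mem_coe, Finset.mem_filter, mem_pairs_iff] at hx
    obtain ⟨⟨-, ⟨-, hp, -⟩, -⟩, hxb⟩ := hx
    simp only
    rw [← hxb, Nat.mul_div_cancel _ hp.pos]

/-- **The cell as a bilinear form**: `Σ_{(m,p) ∈ pairs} g(m p) = Σ_{b ∈ Φ_{j+1}} ω(b) g(b)` for
every `g`. [folklore] -/
theorem sum_pairs_eq_sum_cell {N₀ T j : ℕ} (g : ℕ → ℝ) :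
    ∑ x ∈ pairs N₀ T j, g (x.1 * x.2) = ∑ b ∈ cellΩ N₀ T (j + 1), (ω b : ℝ) * g b := by
  rw [← Finset.sum_fiberwise_of_maps_to (g := fun x : ℕ × ℕ => x.1 * x.2)
    (fun x hx => mul_mem_cell hx)]
  refine Finset.sum_congr rfl fun b hb => ?_
  rw [Finset.sum_congr rfl (fun x hx => by rw [(Finset.mem_filter.1 hx).2]), Finset.sum_const,
    nsmul_eq_mul, card_pairs_filter_mul_eq hb]

/-! ### `ω` on the cell -/

/-- On the cell `Ω = j + 1`: `ω(b) ≤ j + 1` (as `ω ≤ Ω`; cf.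
`AlmostPrimeSieve.cardDistinctFactors_le_cardFactors`). [folklore] -/
theorem omega_le_of_mem_cell {N₀ T j b : ℕ} (hb : b ∈ cellΩ N₀ T (j + 1)) : ω b ≤ j + 1 := by
  rw [← (mem_cell_iff.1 hb).2, ArithmeticFunction.cardDistinctFactors_apply,
    ArithmeticFunction.cardFactors_apply]
  exact (List.dedup_sublist _).length_le

/-- On the cell `Ω = j + 1`: `ω(b) = j + 1` iff `b` is squarefree. [folklore] -/
theorem omega_eq_iff_squarefree_of_mem_cell {N₀ T j b : ℕ} (hb : b ∈ cellΩ N₀ T (j + 1)) :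
    ω b = j + 1 ↔ Squarefree b := by
  obtain ⟨⟨⟨hb1, -⟩, -⟩, hbΩ⟩ := mem_cell_iff.1 hb
  rw [← hbΩ]
  exact ArithmeticFunction.cardDistinctFactors_eq_cardFactors_iff_squarefree (by omega)

/-! ### Counting pairs against counting cell members -/

/-- `#{(m,p) ∈ pairs : P(mp)} = Σ_{b ∈ Φ_{j+1}, P b} ω(b)`. [folklore] -/
theorem card_pairs_filter_eq_sum {N₀ T j : ℕ} (P : ℕ → Prop) [DecidablePred P] :
    (#((pairs N₀ T j).filter (fun x : ℕ × ℕ => P (x.1 * x.2))) : ℝ) =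
      ∑ b ∈ (cellΩ N₀ T (j + 1)).filter P, (ω b : ℝ) := by
  have h := sum_pairs_eq_sum_cell (N₀ := N₀) (T := T) (j := j) (fun b => if P b then (1 : ℝ) else 0)
  rw [Finset.card_eq_sum_ones, Nat.cast_sum, Finset.sum_filter (fun x : ℕ × ℕ => P (x.1 * x.2))]
  push_cast
  rw [h, Finset.sum_filter P]
  refine Finset.sum_congr rfl fun b _ => ?_
  split_ifs <;> simp

/-- `#{(m,p) ∈ pairs : P(mp)} ≤ (j+1) · #{b ∈ Φ_{j+1} : P b}`. [folklore] -/
theorem card_pairs_filter_le {N₀ T j : ℕ} (P : ℕ → Prop) [DecidablePred P] :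
    (#((pairs N₀ T j).filter (fun x : ℕ × ℕ => P (x.1 * x.2))) : ℝ) ≤
      (j + 1) * #((cellΩ N₀ T (j + 1)).filter P) := by
  rw [card_pairs_filter_eq_sum, Finset.card_eq_sum_ones, Nat.cast_sum, Finset.mul_sum]
  refine Finset.sum_le_sum fun b hb => ?_
  have h := omega_le_of_mem_cell (Finset.mem_filter.1 hb).1
  push_cast
  rw [mul_one]
  exact_mod_cast h

/-- `#{(m,p) ∈ pairs : P(mp)} ≤ (j+1) · #{1 ≤ b ≤ T : P b}`. [folklore] -/
theorem card_pairs_filter_le_Icc {N₀ T j : ℕ} (P : ℕ → Prop) [DecidablePred P] :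
    (#((pairs N₀ T j).filter (fun x : ℕ × ℕ => P (x.1 * x.2))) : ℝ) ≤
      (j + 1) * #((Finset.Icc 1 T).filter P) := by
  refine (card_pairs_filter_le P).trans (mul_le_mul_of_nonneg_left ?_ (by positivity))
  exact_mod_cast Finset.card_le_card (Finset.monotone_filter_left _
    ((Finset.filter_subset _ _).trans (roughIcc_subset_Icc _ _)))

/-- `(j+1) #{b ∈ Φ_{j+1} : P b} − #{(m,p) : P(mp)} = Σ_{b ∈ Φ_{j+1}, P b} (j + 1 − ω b)`. [folklore] -/
theorem sub_card_pairs_filter_eq {N₀ T j : ℕ} (P : ℕ → Prop) [DecidablePred P] :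
    ((j + 1 : ℝ) * #((cellΩ N₀ T (j + 1)).filter P) -
        #((pairs N₀ T j).filter (fun x : ℕ × ℕ => P (x.1 * x.2)))) =
      ∑ b ∈ (cellΩ N₀ T (j + 1)).filter P, ((j : ℝ) + 1 - ω b) := by
  rw [card_pairs_filter_eq_sum, Finset.card_eq_sum_ones, Nat.cast_sum, Finset.mul_sum,
    ← Finset.sum_sub_distrib]
  refine Finset.sum_congr rfl fun b _ => ?_
  push_cast; ring

/-- The excess is nonnegative. [folklore] -/
theorem sub_card_pairs_filter_nonneg {N₀ T j : ℕ} (P : ℕ → Prop) [DecidablePred P] :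
    0 ≤ (j + 1 : ℝ) * #((cellΩ N₀ T (j + 1)).filter P) -
        #((pairs N₀ T j).filter (fun x : ℕ × ℕ => P (x.1 * x.2))) := by
  rw [sub_card_pairs_filter_eq]
  refine Finset.sum_nonneg fun b hb => ?_
  have h := omega_le_of_mem_cell (Finset.mem_filter.1 hb).1
  have h' : (ω b : ℝ) ≤ j + 1 := by exact_mod_cast h
  linarith

/-- The excess is at most `(j+1)` times the number of non-squarefree rough `b ≤ T` with `P b`.
[folklore] -/
theorem sub_card_pairs_filter_le {N₀ T j : ℕ} (P : ℕ → Prop) [DecidablePred P] :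
    (j + 1 : ℝ) * #((cellΩ N₀ T (j + 1)).filter P) -
        #((pairs N₀ T j).filter (fun x : ℕ × ℕ => P (x.1 * x.2))) ≤
      (j + 1) * #((Finset.Icc 1 T).filter (fun b : ℕ =>
        ¬ Squarefree b ∧ (∀ p ∈ b.primeFactors, N₀ ≤ p) ∧ P b)) := by
  rw [sub_card_pairs_filter_eq]
  calc ∑ b ∈ (cellΩ N₀ T (j + 1)).filter P, ((j : ℝ) + 1 - ω b)
      ≤ ∑ b ∈ (cellΩ N₀ T (j + 1)).filter P, (if ¬ Squarefree b then ((j : ℝ) + 1) else 0) := by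
        refine Finset.sum_le_sum fun b hb => ?_
        have hb' := (Finset.mem_filter.1 hb).1
        by_cases hsq : Squarefree b
        · rw [if_neg (not_not.2 hsq)]
          have h := (omega_eq_iff_squarefree_of_mem_cell hb').2 hsq
          rw [h]; push_cast; exact le_of_eq (sub_self _)
        · rw [if_pos hsq]
          have : (0 : ℝ) ≤ ω b := Nat.cast_nonneg _
          linarith
    _ = ((j : ℝ) + 1) * #(((cellΩ N₀ T (j + 1)).filter P).filter (fun b => ¬ Squarefree b)) := by
        rw [← Finset.sum_filter, Finset.sum_const, nsmul_eq_mul, mul_comm]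
    _ ≤ ((j : ℝ) + 1) * #((Finset.Icc 1 T).filter (fun b : ℕ =>
          ¬ Squarefree b ∧ (∀ p ∈ b.primeFactors, N₀ ≤ p) ∧ P b)) := by
        refine mul_le_mul_of_nonneg_left ?_ (by positivity)
        refine Nat.cast_le.2 (Finset.card_le_card fun b hb => ?_)
        simp only [Finset.mem_filter] at hb
        rw [Finset.mem_filter]
        exact ⟨roughIcc_subset_Icc _ _ hb.1.1.1, hb.2, (Finset.mem_filter.1 hb.1.1.1).2, hb.1.2⟩

/-! ### The discrepancy of the cell against the discrepancy of the pairs -/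

/-- **The cell discrepancy through the pairs**: for `q ≥ 1` and every class `c`,
`|#{b ∈ Φ_{j+1} : b ≡ c} − #{b ∈ Φ_{j+1} : (b,q)=1}/φ(q)|
 ≤ |#{(m,p) : mp ≡ c} − #{(m,p) : (mp,q)=1}/φ(q)| + #{b ≤ T : b non-squarefree, rough, b ≡ c}
   + #{b ≤ T : b non-squarefree, rough}/φ(q)`. [folklore] -/
theorem abs_cellClassDisc_le_abs_pairDisc_add {N₀ T j q : ℕ} (hq : 0 < q) (c : ℕ) :
    |(#((cellΩ N₀ T (j + 1)).filter (fun b : ℕ => b ≡ c [MOD q])) : ℝ) -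
        (#((cellΩ N₀ T (j + 1)).filter (fun b : ℕ => b.Coprime q)) : ℝ) / (Nat.totient q : ℝ)| ≤
      |(#((pairs N₀ T j).filter (fun x : ℕ × ℕ => x.1 * x.2 ≡ c [MOD q])) : ℝ) -
          (#((pairs N₀ T j).filter (fun x : ℕ × ℕ => (x.1 * x.2).Coprime q)) : ℝ) / (Nat.totient q : ℝ)| +
        #((Finset.Icc 1 T).filter (fun b : ℕ =>
          ¬ Squarefree b ∧ (∀ p ∈ b.primeFactors, N₀ ≤ p) ∧ b ≡ c [MOD q])) +
        (#((Finset.Icc 1 T).filter (fun b : ℕ =>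
          ¬ Squarefree b ∧ (∀ p ∈ b.primeFactors, N₀ ≤ p))) : ℝ) / (Nat.totient q : ℝ) := by
  have hφ : (0 : ℝ) < Nat.totient q := by exact_mod_cast Nat.totient_pos.2 hq
  set A₁ : ℝ := (#((cellΩ N₀ T (j + 1)).filter (fun b : ℕ => b ≡ c [MOD q])) : ℝ) with hA₁
  set A₂ : ℝ := (#((cellΩ N₀ T (j + 1)).filter (fun b : ℕ => b.Coprime q)) : ℝ) with hA₂
  set B₁ : ℝ := (#((pairs N₀ T j).filter (fun x : ℕ × ℕ => x.1 * x.2 ≡ c [MOD q])) : ℝ) with hB₁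
  set B₂ : ℝ := (#((pairs N₀ T j).filter (fun x : ℕ × ℕ => (x.1 * x.2).Coprime q)) : ℝ) with hB₂
  set E₁ : ℝ := (#((Finset.Icc 1 T).filter (fun b : ℕ =>
    ¬ Squarefree b ∧ (∀ p ∈ b.primeFactors, N₀ ≤ p) ∧ b ≡ c [MOD q])) : ℝ) with hE₁
  set E₂ : ℝ := (#((Finset.Icc 1 T).filter (fun b : ℕ =>
    ¬ Squarefree b ∧ (∀ p ∈ b.primeFactors, N₀ ≤ p))) : ℝ) with hE₂
  -- the two excesses
  have h1l : 0 ≤ (j + 1 : ℝ) * A₁ - B₁ := sub_card_pairs_filter_nonneg (fun b : ℕ => b ≡ c [MOD q])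
  have h1u : (j + 1 : ℝ) * A₁ - B₁ ≤ (j + 1) * E₁ := sub_card_pairs_filter_le (fun b : ℕ => b ≡ c [MOD q])
  have h2l : 0 ≤ (j + 1 : ℝ) * A₂ - B₂ := sub_card_pairs_filter_nonneg (fun b : ℕ => b.Coprime q)
  have h2u : (j + 1 : ℝ) * A₂ - B₂ ≤ (j + 1) * E₂ := by
    refine (sub_card_pairs_filter_le (fun b : ℕ => b.Coprime q)).trans
      (mul_le_mul_of_nonneg_left ?_ (by positivity))
    exact Nat.cast_le.2 (Finset.card_le_card (Finset.monotone_filter_right _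
      fun b _ hb => ⟨hb.1, hb.2.1⟩))
  have hj : (1 : ℝ) ≤ j + 1 := by
    have : (0 : ℝ) ≤ j := Nat.cast_nonneg _
    linarith
  have hE₂0 : 0 ≤ E₂ := Nat.cast_nonneg _
  -- `(j+1)(A₁ - A₂/φ) = (B₁ - B₂/φ) + e₁ - e₂/φ`
  have hkey : (j + 1 : ℝ) * (A₁ - A₂ / Nat.totient q) =
      (B₁ - B₂ / Nat.totient q) + ((j + 1) * A₁ - B₁) - ((j + 1) * A₂ - B₂) / Nat.totient q := by
    field_simp; ring
  have habs : (j + 1 : ℝ) * |A₁ - A₂ / Nat.totient q| ≤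
      |B₁ - B₂ / Nat.totient q| + (j + 1) * E₁ + (j + 1) * E₂ / Nat.totient q := by
    rw [← abs_of_pos (by linarith : (0 : ℝ) < j + 1), ← abs_mul, abs_of_pos (by linarith : (0 : ℝ) < j + 1),
      hkey]
    have hdiv : ((j + 1 : ℝ) * A₂ - B₂) / Nat.totient q ≤ (j + 1) * E₂ / Nat.totient q :=
      div_le_div_of_nonneg_right h2u hφ.le
    have hdiv0 : 0 ≤ ((j + 1 : ℝ) * A₂ - B₂) / Nat.totient q := div_nonneg h2l hφ.le
    calc |B₁ - B₂ / ↑q.totient + ((↑j + 1) * A₁ - B₁) - ((↑j + 1) * A₂ - B₂) / ↑q.totient|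
        ≤ |B₁ - B₂ / ↑q.totient + ((↑j + 1) * A₁ - B₁)| + |((↑j + 1) * A₂ - B₂) / ↑q.totient| :=
          abs_sub _ _
      _ ≤ (|B₁ - B₂ / ↑q.totient| + |(↑j + 1) * A₁ - B₁|) + |((↑j + 1) * A₂ - B₂) / ↑q.totient| := by
          gcongr; exact abs_add_le _ _
      _ ≤ (|B₁ - B₂ / ↑q.totient| + (j + 1) * E₁) + (j + 1) * E₂ / Nat.totient q := by
          rw [abs_of_nonneg h1l, abs_of_nonneg hdiv0]
          gcongr
  -- divide by `j + 1 ≥ 1`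
  have hD0 : 0 ≤ |B₁ - B₂ / Nat.totient q| := abs_nonneg _
  have hX0 : 0 ≤ |A₁ - A₂ / Nat.totient q| := abs_nonneg _
  have hE : (j + 1 : ℝ) * (E₁ + E₂ / Nat.totient q) = (j + 1) * E₁ + (j + 1) * E₂ / Nat.totient q := by ring
  have h3 : (j + 1 : ℝ) * |A₁ - A₂ / Nat.totient q| ≤
      (j + 1) * (|B₁ - B₂ / Nat.totient q| + E₁ + E₂ / Nat.totient q) := by
    calc (j + 1 : ℝ) * |A₁ - A₂ / Nat.totient q|
        ≤ |B₁ - B₂ / Nat.totient q| + (j + 1) * E₁ + (j + 1) * E₂ / Nat.totient q := habs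
      _ ≤ (j + 1) * |B₁ - B₂ / Nat.totient q| + (j + 1) * E₁ + (j + 1) * E₂ / Nat.totient q := by
          nlinarith
      _ = (j + 1) * (|B₁ - B₂ / Nat.totient q| + E₁ + E₂ / Nat.totient q) := by ring
  exact le_of_mul_le_mul_left h3 (by linarith)

end RoughCellsAP

end Literature.NumberTheory.Sieve
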